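import Summits.CriticalPhenomena.CardyFormulaZ2.Theorems.CardyWhiteToColouredSimilarityUpgradeOfRectilinearHeart
import Summits.CriticalPhenomena.CardyFormulaZ2.Theorems.CardyWickAnisotropyBoxFamilyToCardyStubDomainContinuity

/-!
# One-map reduction of crux `SimilarityUpgrade` (stmt-CriticalPhenomena-4597): the crux follows from
# ONE model-free theorem (U) and ONE identity (Z: invariance of full limits under `z ↦ z²`)

Lead c6 of line `registered` (prover-line-stmt-CriticalPhenomena-4597-c6-0, 2026-08-17); registered
goal-stub `stub_oneMapReduction`; companion of the crux idea card `Cruxes/SimilarityUpgrade/Ideas/one-map-upgrade.md`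
and of the typed sketch `Cruxes/SimilarityUpgrade/OneMapSketch.lean` (same statements, there as named `def`s).

Write, for a functional `Φ` on conformal rectangles:
* (LC) loop continuity — `Φ R'` is `ε`-close to `Φ R` once the boundary parametrisation of `R'` is
  uniformly `η`-close to that of `R` and the mark parameters are `η`-close;
* (AI) invariance under complex affine maps — verbatim hypothesis (ii) of the crux;
* (SQ) invariance under the ONE extra map `S : z ↦ z²` on quads whose closed carrier lies in the open
  upper half-plane (carrier and arcs 0, 2 of `R'` the `S`-images of those of `R` ⇒ `Φ R' = Φ R`);
* (MD) `Φ` is a function of the conformal modulus (equal cross-ratio of uniformizing data ⇒ equal values);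
* (FL) `Φ` is the full limit of the bond-ℤ² crossing probabilities.

This file proves, sorry-free over tree theorems:
* `fullLimit_loopContinuous` — **(FL) ⇒ (LC)**: full limits are loop-continuous, from the tree theorem
  `BoxFamilyToCardy.Birth.stub_domainContinuity` (S2 of stmt-0794 / stmt-14215: mesh-uniform loop
  continuity of `bondDomainCrossingProb`, Schramm–Smirnov 2011 Lemma 5.1 technology) by passing to the
  limit along the non-trivial filter `𝓝[>] 0`;
* `stub_oneMapReduction` — **U → Z → `SimilarityUpgrade`**, where
  U := `∀ Φ, (LC) → (AI) → (SQ) → (MD)` is the ONE-MAP UPGRADE, a true statement of classical complex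
  analysis (Loewner's vertical slit maps `x + √((z-x)² + 4s)` are exactly words
  `T_x ∘ S⁻¹ ∘ T_{4s} ∘ S ∘ T_{-x}`; words are Loewner maps of step drivers and converge to hull
  uniformizers; real Möbius maps arise from the Euler scheme `((2/h)(√(1+h·)-1))^{∘n} → z/(1+tz)`;
  inversion, square-model exhaustion and Carathéodory extension finish — NOT formalised here, taken as
  the hypothesis `hU`), and Z := `∀ Φ, (FL) → (AI) → (SQ)` is the single identity carrying the whole
  conformal content of the crux (open; an instance of Schramm's Problem 2.11). Proof: for a full,
  affine-invariant `Φ`, (LC) holds by `fullLimit_loopContinuous`, (SQ) by Z, so (MD) by U; (MD) gives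
  the registered heart H3 of line `registered` verbatim, and `similarityUpgrade_of_rectilinearHeart`
  (c2) returns the crux by name.

References: O. Schramm, S. Smirnov, Ann. Probab. 39 (2011), Lemma 5.1, eq. (5.1); G. F. Lawler,
*Conformally Invariant Processes in the Plane* (2005), §4.1 Prop. 4.4, §4.7 Prop. 4.47–4.48;
G. F. Lawler, O. Schramm, W. Werner, JAMS 16 (2003), proof of Lemma 3.5; O. Schramm, Proc. ICM 2006,
§2.6 Problem 2.11.
-/

noncomputable section

namespace Summit.CriticalPhenomena.CardyFormulaZ2.Theorems.SimilarityUpgradeReduction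

open Filter Topology Set
open Literature.Probability.RandomPlanarGeometry
open Literature.Probability.Percolation (bondDomainCrossingProb)
open Summit.CriticalPhenomena.CardyFormulaZ2.Cruxes

/-- **Full limits are loop-continuous** ((FL) ⇒ (LC)): from the mesh-uniform loop continuity of the
bond-ℤ² crossing probabilities (`stub_domainContinuity`, tree) by `le_of_tendsto` along `𝓝[>] 0`.
[cite: SchrammSmirnov2011, Lemma 5.1 and eq. (5.1)] -/
theorem fullLimit_loopContinuous : ∀ Φ : ConformalRectangle → ℝ, (∀ R : ConformalRectangle, Tendsto (bondDomainCrossingProb R) (𝓝[>] (0 : ℝ)) (𝓝 (Φ R))) → (∀ R : ConformalRectangle, ∀ ε : ℝ, 0 < ε → ∃ η : ℝ, 0 < η ∧ ∀ R' : ConformalRectangle, (∀ t : ℝ, dist (R'.boundary t) (R.boundary t) ≤ η) → (∀ i : Fin 4, |R'.mark i - R.mark i| ≤ η) → |Φ R' - Φ R| ≤ ε) := by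
  intro Φ hF R ε hε
  obtain ⟨η, hη, h⟩ := BoxFamilyToCardy.Birth.stub_domainContinuity R ε hε
  refine ⟨η, hη, fun R' hb hm => ?_⟩
  have hlim : Tendsto (fun δ : ℝ => |bondDomainCrossingProb R' δ - bondDomainCrossingProb R δ|)
      (𝓝[>] (0 : ℝ)) (𝓝 |Φ R' - Φ R|) :=
    ((hF R').sub (hF R)).abs
  exact le_of_tendsto hlim (h R' hb hm)

/-- **stub_oneMapReduction (c6 goal; the one-map reduction).** The crux `SimilarityUpgrade` follows from
the ONE-MAP UPGRADE U (loop continuity + affine invariance + invariance under `z ↦ z²` on quads in `ℍ`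
⇒ function of the modulus; model-free, true, not formalised here) and the single identity Z (full,
affine-invariant limits are `z²`-invariant; open): loop continuity of full limits is
`fullLimit_loopContinuous`, so U yields the modulus statement (MD), which contains the registered heart
H3, and `similarityUpgrade_of_rectilinearHeart` returns the crux. [cite: Schramm2007ICM, §2.6 Problem 2.11] -/
theorem stub_oneMapReduction : (∀ Φ : ConformalRectangle → ℝ, (∀ R : ConformalRectangle, ∀ ε : ℝ, 0 < ε → ∃ η : ℝ, 0 < η ∧ ∀ R' : ConformalRectangle, (∀ t : ℝ, dist (R'.boundary t) (R.boundary t) ≤ η) → (∀ i : Fin 4, |R'.mark i - R.mark i| ≤ η) → |Φ R' - Φ R| ≤ ε) → (∀ (R R' : ConformalRectangle) (a w : ℂ), a ≠ 0 → R'.carrier = (fun z : ℂ => a * z + w) '' R.carrier → R'.arc 0 = (fun z : ℂ => a * z + w) '' R.arc 0 → R'.arc 2 = (fun z : ℂ => a * z + w) '' R.arc 2 → Φ R' = Φ R) → (∀ R R' : ConformalRectangle, closure R.carrier ⊆ {z : ℂ | 0 < z.im} → R'.carrier = (fun z : ℂ => z ^ 2) '' R.carrier → R'.arc 0 = (fun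 z : ℂ => z ^ 2) '' R.arc 0 → R'.arc 2 = (fun z : ℂ => z ^ 2) '' R.arc 2 → Φ R' = Φ R) → (∀ (R R' : ConformalRectangle) (φ : ConformalEquiv UpperHalfPlane.upperHalfPlaneSet R.carrier) (x : Fin 4 → ℝ) (φ' : ConformalEquiv UpperHalfPlane.upperHalfPlaneSet R'.carrier) (x' : Fin 4 → ℝ), R.IsUniformizing φ x → R'.IsUniformizing φ' x' → crossRatio x = crossRatio x' → Φ R = Φ R')) → (∀ Φ : ConformalRectangle → ℝ, (∀ R : ConformalRectangle, Tendsto (bondDomainCrossingProb R) (𝓝[>] (0 : ℝ)) (𝓝 (Φ R))) → (∀ (R R' : ConformalRectangle) (a w : ℂ), a ≠ 0 → R'.carrier = (fun z : ℂ => a * z + w) '' R.carrier → R'.arc 0 = (fun z : ℂ => a * z + w) '' R.arc 0 → R'.arc 2 = (fun z : ℂ => a * z + w) '' R.arc 2 → Φ R' = Φ R) → (∀ R R' : ConformalRectangle, closure R.carrier ⊆ {z : ℂ | 0 < z.im} → R'.carrier = (fun z : ℂ => z ^ 2) '' R.carrier → R'.arc 0 = (fun z : ℂ => z ^ 2) ''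 R.arc 0 → R'.arc 2 = (fun z : ℂ => z ^ 2) '' R.arc 2 → Φ R' = Φ R)) → Summit.CriticalPhenomena.CardyFormulaZ2.Theses.CardyWhiteToColoured.SimilarityUpgrade := by
  intro hU hZ
  refine similarityUpgrade_of_rectilinearHeart ?_
  intro Φ hF hA R R' _ _ φ x φ' x' hx hx' hη
  exact hU Φ (fullLimit_loopContinuous Φ hF) hA (hZ Φ hF hA) R R' φ x φ' x' hx hx' hη

end Summit.CriticalPhenomena.CardyFormulaZ2.Theorems.SimilarityUpgradeReduction

end
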